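/-
Copyright: cell pub-balaban-gaps, seat ne8 (estimate NE7c), gen 19. Project licence.
-/
import Summits.QuantumFields.BalabanUV.T4Continuum.Spine.NE7c.LiveFactorAdaptiveTreeModel
import Summits.QuantumFields.BalabanUV.T4Continuum.Spine.NE7c.LiveFactorGlobalAdaptiveModel

/-!
# Road (δ)'s constructor needs the two-run closeness only EVENTUALLY in the cutoff: `T4IndicatorShell.ShellWeightBound` tolerates ANY behaviour
# below a cutoff `K₀` (relative weight `1` there), so BOTH members — (δ-1) and the member OF RECORD — fire on adaptive trees under any joint law with the
# closeness (and the record's window bookkeeping) asked for `K ≥ K₀` alone (row NE7c; junction J-30; MODEL, [folklore])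

Cell `pub-balaban-gaps` (G2), seat ne8, estimate **NE7c** (`T4IndicatorShell.ShellWeightBound`; two-run artefact, NOT PRINTED in [Bałaban 1983–89], NOT
PROVED).  Proof-only file under `Spine/NE7c/`: imports this seat's files 50 `LiveFactorAdaptiveTreeModel` (`shellWeightBound_adaptiveTree`; through it
`T4GenFunBounds.gibbsMeasure`, `Missing.TorusScheme`, `Missing.plaqLoop`) and 52 `LiveFactorGlobalAdaptiveModel` (`shellWeightBound_globalAdaptiveTree`) only;
nothing of Bałaban's is named; no `def`; classical decidability; 0 `sorry`.

THE QUESTION (census `HOME/ne/NE7c.md` §27 item 2, the supplier «node U1b»).  Every member of road (δ) typed so far takes the two-run closeness radii at a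
rate from `K = 0` on: file 50's `shellWeightBound_adaptiveTree` asks `2ρ^X_{K,t} ≤ c₁ϑ^K` for EVERY comparison `K` (with `2c₁ ≤ β′ ≤ 1`, so in
particular every radius is `≤ 1∕4` in threshold units).  The spine's closeness (node U1b ∕ the NE3 species) is an ASYMPTOTIC statement — run A
(lattice spacing `L^{−K}`) and run B (`L^{−K−1}`) are close only for `K` large; at `K = 0` they are not close at all.  Is the `∀ K` a real demand of
road (δ), or bookkeeping?

ANSWER ([folklore]): bookkeeping.  `T4IndicatorShell.ShellWeightBound` is a RELATIVE bound (`Σ shell parts ≤ Wsh_K · Σ terms`) with `Wsh` summable;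
since every shell part is at most its term (`sh_le`), the weight `Wsh_K = 1` is always admissible, and finitely many `K` do not affect summability.
* §1 (generic, any index type) **`shellWeightBound_of_shift`**: if `ShellWeightBound l₀` holds for the SHIFTED families `K ↦ T (K₀+K), A (K₀+K), …` with
  weights `Wsh`, and below `K₀` the shell parts are merely nonnegative and dominated by their terms, then `ShellWeightBound l₀ T A B shA shB` holds with
  any weights `W` with `W K = 1` (`K < K₀`), `W (K₀ + K) = Wsh K`.
* §2 **`shellWeightBound_adaptiveTree_eventually`** — file 50's END-TO-END constructor on ADAPTIVE decision trees under ANY joint law (any probability space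
  and measurable real observables per run and comparison, thresholds `θ ≥ 0`, at most `ν_σ` booked tests per live stage given the history) with the
  closeness hypotheses `2ρ^X_{K,t} ≤ c₁ϑ^K` and the stage budgets asked ONLY for `K ≥ K₀` (`K₀` arbitrary; below it radii merely `≥ 0`, trees arbitrary): ONE `i⋆` with, for every
  `K ≥ K₀`, `i⋆K < ⌊β′∕(c₁ϑ^K)⌋₊` and BOTH runs' chosen booked-shell masses `≤ ((2∏_{σ<S}(ν_σ+1) − 2)·4c₁∕β′)·ϑ^K` — the SAME ceiling as file 50 —, and
  `T4IndicatorShell.ShellWeightBound` BY NAME with weights `= 1` below `K₀` and `=` the two chosen masses from `K₀` on.  Proof: file 50 applied to the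
  shifted data with the constant `c₁ϑ^{K₀}` (still `2c₁ϑ^{K₀} ≤ β′`), then §1.
* §3 **`shellWeightBound_globalAdaptiveTree_eventually`** — the member OF RECORD (file 52's `shellWeightBound_globalAdaptiveTree`: ONE global assignment by
  LEVEL, per-level shell widths `ρ⋆_j`, per-run adaptive trees with per-level budgets, window bookkeeping `W K` ∕ `B j` ∕ loss factors ∕ majorant) with the
  closeness `2ρ^X_{K,t} ≤ ρ⋆_{lev}`, the live-window reading `lev ∈ W K` and the majorant `≤ C·ϑ^K` asked ONLY for `K ≥ K₀`: the same conclusion with weights `1`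
  below `K₀` (file 52 at the shifted data, books `B_j ↦ B_j − K₀`, constant `C·ϑ^{K₀}`; then §1 — no constant to rewrite, the factors are indexed by level).
* §4 **`shellWeightBound_wilsonScheme_adaptive_eventually`** — §2's member (δ-1) on CONSECUTIVE LATTICES of ANY torus scheme (Wilson–Gibbs at cutoffs `K`, `K+1`;
  plaquette-action tests through each run's own adaptive tree; file 50 §5's instance) with closeness only for `K ≥ K₀`.

CENSUS.  Instance row J-30 (no new letter): the supplier line «node U1b» of `ne/NE7c.md` §27 item 2 reads «`2ρ^X_{K,t} ≤ ρs(lev)` resp. `≤ c₁ϑ^K` for all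
SUFFICIENTLY LARGE `K`» — the form in which two-run closeness is actually available.  MODEL: the trees are ARBITRARY (node O untouched); census-neutral;
word UNCHANGED: WORK-bound behind node O; INSTANCE 0∕1.  NE7c ∕ NE7b NOT PRINTED ∕ NOT PROVED; spine 0∕9; one finite T⁴ — NOT ℝ⁴, NOT infinite volume,
NOT the mass gap, NOT Clay.
-/

set_option autoImplicit false

noncomputable section

open MeasureTheory Finset Set
open scoped Classical ENNReal
open Literature.MathematicalPhysics.QuantumFieldTheory.Balaban1983to89
open Literature.MathematicalPhysics.QuantumFieldTheory.Balaban1983to89.T4ShellMeasure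
open Summit.QuantumFields.BalabanUV.T4Continuum.Spine.NE7c.LiveFactorAdaptiveTreeModel (shellWeightBound_adaptiveTree)
open Summit.QuantumFields.BalabanUV.T4Continuum.Spine.NE7c.LiveFactorGlobalAdaptiveModel (shellWeightBound_globalAdaptiveTree)

namespace Summit.QuantumFields.BalabanUV.T4Continuum.Spine.NE7c.LiveFactorEventually

/-! ## §1 `ShellWeightBound` is insensitive to finitely many comparisons -/

section Generic

variable {ι : Type*} {l₀ : ℝ} {T : ℕ → Finset ι} {A B shA shB : ℕ → ℝ → ι → ℝ}

/-- **HEAD REPLACEMENT.**  If `T4IndicatorShell.ShellWeightBound l₀` holds for the SHIFTED data `K ↦ (T, A, B, shA, shB) (K₀ + K)` with weights `Wsh`, and for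
`K < K₀` the shell parts are nonnegative and at most their terms, then it holds for the original data with any weights `W` equal to `1` below `K₀` and to `Wsh (K − K₀)` from
`K₀` on (the relative bound with weight `1` is `sh ≤ A` summed; summability ignores finitely many indices, `summable_nat_add_iff`). [folklore] -/
theorem shellWeightBound_of_shift (K₀ : ℕ) {Wsh W : ℕ → ℝ}
    (h : T4IndicatorShell.ShellWeightBound l₀ (fun K => T (K₀ + K)) (fun K => A (K₀ + K)) (fun K => B (K₀ + K))
      (fun K => shA (K₀ + K)) (fun K => shB (K₀ + K)) Wsh)
    (hW0 : ∀ K, K < K₀ → W K = 1) (hW : ∀ K, W (K₀ + K) = Wsh K)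
    (h0A : ∀ K, K < K₀ → ∀ t : ℝ, |t| ≤ l₀ → ∀ τ ∈ T K, 0 ≤ shA K t τ) (hleA : ∀ K, K < K₀ → ∀ t : ℝ, |t| ≤ l₀ → ∀ τ ∈ T K, shA K t τ ≤ A K t τ)
    (h0B : ∀ K, K < K₀ → ∀ t : ℝ, |t| ≤ l₀ → ∀ τ ∈ T K, 0 ≤ shB K t τ) (hleB : ∀ K, K < K₀ → ∀ t : ℝ, |t| ≤ l₀ → ∀ τ ∈ T K, shB K t τ ≤ B K t τ) :
    T4IndicatorShell.ShellWeightBound l₀ T A B shA shB W := by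
  have hsplit : ∀ K, ¬ K < K₀ → ∃ K', K = K₀ + K' := fun K hK => ⟨K - K₀, by omega⟩
  refine ⟨fun K => ?_, ?_, fun K t ht τ hτ => ?_, fun K t ht τ hτ => ?_, fun K t ht τ hτ => ?_, fun K t ht τ hτ => ?_, fun K t ht => ?_, fun K t ht => ?_⟩
  · by_cases hK : K < K₀
    · rw [hW0 K hK]; exact zero_le_one
    · obtain ⟨K', rfl⟩ := hsplit K hK; rw [hW]; exact h.nonneg _
  · refine (summable_nat_add_iff K₀).mp ?_
    have e : (fun n => W (n + K₀)) = Wsh := by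
      funext n; rw [add_comm, hW]
    rw [e]; exact h.summable
  · by_cases hK : K < K₀
    · exact h0A K hK t ht τ hτ
    · obtain ⟨K', rfl⟩ := hsplit K hK; exact h.sh_nonneg_left K' t ht τ hτ
  · by_cases hK : K < K₀
    · exact hleA K hK t ht τ hτ
    · obtain ⟨K', rfl⟩ := hsplit K hK; exact h.sh_le_left K' t ht τ hτ
  · by_cases hK : K < K₀
    · exact h0B K hK t ht τ hτ
    · obtain ⟨K', rfl⟩ := hsplit K hK; exact h.sh_nonneg_right K' t ht τ hτ
  · by_cases hK : K < K₀
    · exact hleB K hK t ht τ hτ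
    · obtain ⟨K', rfl⟩ := hsplit K hK; exact h.sh_le_right K' t ht τ hτ
  · by_cases hK : K < K₀
    · rw [hW0 K hK, one_mul]; exact Finset.sum_le_sum fun τ hτ => hleA K hK t ht τ hτ
    · obtain ⟨K', rfl⟩ := hsplit K hK
      rw [hW]; exact h.left K' t ht
  · by_cases hK : K < K₀
    · rw [hW0 K hK, one_mul]; exact Finset.sum_le_sum fun τ hτ => hleB K hK t ht τ hτ
    · obtain ⟨K', rfl⟩ := hsplit K hK
      rw [hW]; exact h.right K' t ht

end Generic

/-! ## §2 Member (δ-1) on adaptive trees under any joint law, closeness asked only for `K ≥ K₀` -/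

section AdaptiveTree

variable {α τ : Type*} [DecidableEq α] [Fintype τ] [DecidableEq τ] {S : ℕ}
  {ΩA ΩB : ℕ → Type*} [∀ K, MeasurableSpace (ΩA K)] [∀ K, MeasurableSpace (ΩB K)]
  (PA : ∀ K, Measure (ΩA K)) (PB : ∀ K, Measure (ΩB K)) [∀ K, IsProbabilityMeasure (PA K)] [∀ K, IsProbabilityMeasure (PB K)]
  (uA : ∀ K, τ → ΩA K → ℝ) (uB : ∀ K, τ → ΩB K → ℝ) (θ ρA ρB : ℕ → τ → ℝ)
  (testsA testsB : ℕ → ℕ → α → Finset τ) (nextA nextB : ℕ → ℕ → α → Finset τ → α) (aA aB : ℕ → α) (ν : ℕ → ℕ)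

/-- **ROAD (δ)'s END-TO-END CONSTRUCTOR ON ADAPTIVE TREES, CLOSENESS ONLY EVENTUALLY.**  File 50's `shellWeightBound_adaptiveTree` with the closeness
hypotheses `2ρ^X_{K,t} ≤ c₁ϑ^K` and the stage budgets `#tests ≤ ν_σ` asked only for `K ≥ K₀` (`K₀ : ℕ` arbitrary; for `K < K₀` the radii are merely `≥ 0`
and the trees, thresholds, laws arbitrary): ONE choice function `i⋆` such that for every `K ≥ K₀`, `i⋆K < ⌊β′∕(c₁ϑ^K)⌋₊` and both runs' chosen booked-shell masses are
`≤ ((2∏_{σ<S}(ν_σ+1) − 2)·4c₁∕β′)·ϑ^K` (file 50's ceiling, unchanged), and `T4IndicatorShell.ShellWeightBound l₀` BY NAME for the two runs' cell data at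
`i⋆`, with weights `Wsh_K = 1` for `K < K₀` and `Wsh_K =` the sum of the two chosen masses for `K ≥ K₀`.  Consumed: file 50 at the shifted data with
constant `c₁ϑ^{K₀}`, §1. [folklore] -/
theorem shellWeightBound_adaptiveTree_eventually (K₀ : ℕ) (l₀ : ℝ) {c₁ β' ϑ : ℝ} (hc₁ : 0 < c₁) (h2 : 2 * c₁ ≤ β') (hβ1 : β' ≤ 1)
    (hϑ0 : 0 < ϑ) (hϑ1 : ϑ < 1) (huA : ∀ K t, Measurable (uA K t)) (huB : ∀ K t, Measurable (uB K t)) (hθ : ∀ K t, 0 ≤ θ K t)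
    (hA0 : ∀ K t, 0 ≤ ρA K t) (hA2 : ∀ K, K₀ ≤ K → ∀ t, 2 * ρA K t ≤ c₁ * ϑ ^ K) (hB0 : ∀ K t, 0 ≤ ρB K t)
    (hB2 : ∀ K, K₀ ≤ K → ∀ t, 2 * ρB K t ≤ c₁ * ϑ ^ K) (hνA : ∀ K, K₀ ≤ K → ∀ σ a, (testsA K σ a).card ≤ ν σ)
    (hνB : ∀ K, K₀ ≤ K → ∀ σ a, (testsB K σ a).card ≤ ν σ) :
    ∃ istar : ℕ → ℕ, ∃ Wsh : ℕ → ℝ, (∀ K, K < K₀ → Wsh K = 1) ∧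
      (∀ K, K₀ ≤ K → istar K < ⌊β' / (c₁ * ϑ ^ K)⌋₊ ∧
        ∑ p : Fin S × τ, ∑ ω : τ → Bool, (PA K).real ((⋂ t, (uA K t) ⁻¹' (if ω t then Iio (θ K t * (1 - c₁ * ϑ ^ K) ^ istar K) else Ici (θ K t * (1 - c₁ * ϑ ^ K) ^ istar K))) ∩ {x | p.2 ∈ testsA K p.1 (Nat.rec (motive := fun _ => α) (aA K) (fun σ a => nextA K σ a ((testsA K σ a).filter fun t => ω t = true)) p.1) ∧ uA K p.2 x ∈ twoSidedShell (θ K p.2) (c₁ * ϑ ^ K) (ρA K p.2) (istar K)}) ≤ (((2 * ∏ σ ∈ range S, (ν σ + 1) - 2 : ℕ) : ℝ) * (4 * c₁ / β')) * ϑ ^ K ∧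
        ∑ p : Fin S × τ, ∑ ω : τ → Bool, (PB K).real ((⋂ t, (uB K t) ⁻¹' (if ω t then Iio (θ K t * (1 - c₁ * ϑ ^ K) ^ istar K) else Ici (θ K t * (1 - c₁ * ϑ ^ K) ^ istar K))) ∩ {x | p.2 ∈ testsB K p.1 (Nat.rec (motive := fun _ => α) (aB K) (fun σ a => nextB K σ a ((testsB K σ a).filter fun t => ω t = true)) p.1) ∧ uB K p.2 x ∈ twoSidedShell (θ K p.2) (c₁ * ϑ ^ K) (ρB K p.2) (istar K)}) ≤ (((2 * ∏ σ ∈ range S, (ν σ + 1) - 2 : ℕ) : ℝ) * (4 * c₁ / β')) * ϑ ^ K ∧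
        Wsh K = ∑ p : Fin S × τ, ∑ ω : τ → Bool, (PA K).real ((⋂ t, (uA K t) ⁻¹' (if ω t then Iio (θ K t * (1 - c₁ * ϑ ^ K) ^ istar K) else Ici (θ K t * (1 - c₁ * ϑ ^ K) ^ istar K))) ∩ {x | p.2 ∈ testsA K p.1 (Nat.rec (motive := fun _ => α) (aA K) (fun σ a => nextA K σ a ((testsA K σ a).filter fun t => ω t = true)) p.1) ∧ uA K p.2 x ∈ twoSidedShell (θ K p.2) (c₁ * ϑ ^ K) (ρA K p.2) (istar K)}) +
          ∑ p : Fin S × τ, ∑ ω : τ → Bool, (PB K).real ((⋂ t, (uB K t) ⁻¹' (if ω t then Iio (θ K t * (1 - c₁ * ϑ ^ K) ^ istar K) else Ici (θ K t * (1 - c₁ * ϑ ^ K) ^ istar K))) ∩ {x | p.2 ∈ testsB K p.1 (Nat.rec (motive := fun _ => α) (aB K) (fun σ a => nextB K σ a ((testsB K σ a).filter fun t => ω t = true)) p.1) ∧ uB K p.2 x ∈ twoSidedShell (θ K p.2) (c₁ * ϑ ^ K) (ρB K p.2) (istar K)})) ∧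
      T4IndicatorShell.ShellWeightBound l₀ (fun _ => (univ : Finset (τ → Bool)))
        (fun K (_ : ℝ) (ω : τ → Bool) => (PA K).real (⋂ t, (uA K t) ⁻¹' (if ω t then Iio (θ K t * (1 - c₁ * ϑ ^ K) ^ istar K) else Ici (θ K t * (1 - c₁ * ϑ ^ K) ^ istar K))))
        (fun K (_ : ℝ) (ω : τ → Bool) => (PB K).real (⋂ t, (uB K t) ⁻¹' (if ω t then Iio (θ K t * (1 - c₁ * ϑ ^ K) ^ istar K) else Ici (θ K t * (1 - c₁ * ϑ ^ K) ^ istar K))))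
        (fun K (_ : ℝ) (ω : τ → Bool) => (PA K).real ((⋂ t, (uA K t) ⁻¹' (if ω t then Iio (θ K t * (1 - c₁ * ϑ ^ K) ^ istar K) else Ici (θ K t * (1 - c₁ * ϑ ^ K) ^ istar K))) ∩ ⋃ p : Fin S × τ, {x | p.2 ∈ testsA K p.1 (Nat.rec (motive := fun _ => α) (aA K) (fun σ a => nextA K σ a ((testsA K σ a).filter fun t => ω t = true)) p.1) ∧ uA K p.2 x ∈ twoSidedShell (θ K p.2) (c₁ * ϑ ^ K) (ρA K p.2) (istar K)}))
        (fun K (_ : ℝ) (ω : τ → Bool) => (PB K).real ((⋂ t, (uB K t) ⁻¹' (if ω t then Iio (θ K t * (1 - c₁ * ϑ ^ K) ^ istar K) else Ici (θ K t * (1 - c₁ * ϑ ^ K) ^ istar K))) ∩ ⋃ p : Fin S × τ, {x | p.2 ∈ testsB K p.1 (Nat.rec (motive := fun _ => α) (aB K) (fun σ a => nextB K σ a ((testsB K σ a).filter fun t => ω t = true)) p.1) ∧ uB K p.2 x ∈ twoSidedShell (θ K p.2) (c₁ * ϑ ^ K) (ρB K p.2) (istar K)}))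
        Wsh := by
  -- the shifted data: comparison `K` of the new families is comparison `K₀ + K` of the given ones; constant `c₁ϑ^{K₀}`
  have hq0 : 0 < ϑ ^ K₀ := pow_pos hϑ0 K₀
  have hq1 : ϑ ^ K₀ ≤ 1 := pow_le_one₀ hϑ0.le hϑ1.le
  have hc₁' : 0 < c₁ * ϑ ^ K₀ := mul_pos hc₁ hq0
  have h2' : 2 * (c₁ * ϑ ^ K₀) ≤ β' := by nlinarith
  have key : ∀ K, c₁ * ϑ ^ (K₀ + K) = c₁ * ϑ ^ K₀ * ϑ ^ K := fun K => by rw [pow_add, mul_assoc]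
  obtain ⟨istar', h1, hSWB⟩ := shellWeightBound_adaptiveTree (S := S) (PA := fun K => PA (K₀ + K)) (PB := fun K => PB (K₀ + K))
    (uA := fun K => uA (K₀ + K)) (uB := fun K => uB (K₀ + K)) (θ := fun K => θ (K₀ + K)) (ρA := fun K => ρA (K₀ + K)) (ρB := fun K => ρB (K₀ + K))
    (testsA := fun K => testsA (K₀ + K)) (testsB := fun K => testsB (K₀ + K)) (nextA := fun K => nextA (K₀ + K)) (nextB := fun K => nextB (K₀ + K))
    (aA := fun K => aA (K₀ + K)) (aB := fun K => aB (K₀ + K)) (ν := ν) l₀ hc₁' h2' hβ1 hϑ0 hϑ1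
    (fun K t => huA (K₀ + K) t) (fun K t => huB (K₀ + K) t) (fun K t => hθ (K₀ + K) t)
    (fun K t => hA0 (K₀ + K) t) (fun K t => (hA2 (K₀ + K) (Nat.le_add_right K₀ K) t).trans_eq (key K))
    (fun K t => hB0 (K₀ + K) t) (fun K t => (hB2 (K₀ + K) (Nat.le_add_right K₀ K) t).trans_eq (key K))
    (fun K σ a => hνA (K₀ + K) (Nat.le_add_right K₀ K) σ a) (fun K σ a => hνB (K₀ + K) (Nat.le_add_right K₀ K) σ a)
  have hlt : ∀ K, ¬ K₀ + K < K₀ := fun K => by omega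
  refine ⟨fun K => if K < K₀ then 0 else istar' (K - K₀),
    (fun K => if K < K₀ then (1 : ℝ) else
      ∑ p : Fin S × τ, ∑ ω : τ → Bool, (PA K).real ((⋂ t, (uA K t) ⁻¹' (if ω t then Iio (θ K t * (1 - c₁ * ϑ ^ K) ^ (fun K => if K < K₀ then 0 else istar' (K - K₀)) K) else Ici (θ K t * (1 - c₁ * ϑ ^ K) ^ (fun K => if K < K₀ then 0 else istar' (K - K₀)) K))) ∩ {x | p.2 ∈ testsA K p.1 (Nat.rec (motive := fun _ => α) (aA K) (fun σ a => nextA K σ a ((testsA K σ a).filter fun t => ω t = true)) p.1) ∧ uA K p.2 x ∈ twoSidedShell (θ K p.2) (c₁ * ϑ ^ K) (ρA K p.2) ((fun K => if K < K₀ then 0 else istar' (K - K₀)) K)}) +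
      ∑ p : Fin S × τ, ∑ ω : τ → Bool, (PB K).real ((⋂ t, (uB K t) ⁻¹' (if ω t then Iio (θ K t * (1 - c₁ * ϑ ^ K) ^ (fun K => if K < K₀ then 0 else istar' (K - K₀)) K) else Ici (θ K t * (1 - c₁ * ϑ ^ K) ^ (fun K => if K < K₀ then 0 else istar' (K - K₀)) K))) ∩ {x | p.2 ∈ testsB K p.1 (Nat.rec (motive := fun _ => α) (aB K) (fun σ a => nextB K σ a ((testsB K σ a).filter fun t => ω t = true)) p.1) ∧ uB K p.2 x ∈ twoSidedShell (θ K p.2) (c₁ * ϑ ^ K) (ρB K p.2) ((fun K => if K < K₀ then 0 else istar' (K - K₀)) K)})),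
    fun K hK => by simp only [hK, if_true], fun K hK => ?_, ?_⟩
  · -- the tail: comparison `K = K₀ + K'` of the given data is comparison `K'` of the shifted data
    obtain ⟨K', rfl⟩ : ∃ K', K = K₀ + K' := ⟨K - K₀, by omega⟩
    obtain ⟨hi, hmA, hmB⟩ := h1 K'
    have eV : (((2 * ∏ σ ∈ range S, (ν σ + 1) - 2 : ℕ) : ℝ) * (4 * (c₁ * ϑ ^ K₀) / β')) * ϑ ^ K' =
        (((2 * ∏ σ ∈ range S, (ν σ + 1) - 2 : ℕ) : ℝ) * (4 * c₁ / β')) * ϑ ^ (K₀ + K') := by rw [pow_add]; ring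
    simp only [hlt, if_false, Nat.add_sub_cancel_left, key]
    exact ⟨hi, hmA.trans_eq eV, hmB.trans_eq eV, trivial⟩
  · -- `ShellWeightBound`: §1 with the shifted bound of file 50
    refine shellWeightBound_of_shift (T := fun _ => (univ : Finset (τ → Bool)))
      (Wsh := fun K => ∑ p : Fin S × τ, ∑ ω : τ → Bool, (PA (K₀ + K)).real ((⋂ t, (uA (K₀ + K) t) ⁻¹' (if ω t then Iio (θ (K₀ + K) t * (1 - c₁ * ϑ ^ K₀ * ϑ ^ K) ^ istar' K) else Ici (θ (K₀ + K) t * (1 - c₁ * ϑ ^ K₀ * ϑ ^ K) ^ istar' K))) ∩ {x | p.2 ∈ testsA (K₀ + K) p.1 (Nat.rec (motive := fun _ => α) (aA (K₀ + K)) (fun σ a => nextA (K₀ + K) σ a ((testsA (K₀ + K) σ a).filter fun t => ω t = true)) p.1) ∧ uA (K₀ + K) p.2 x ∈ twoSidedShell (θ (K₀ + K) p.2) (c₁ * ϑ ^ K₀ * ϑ ^ K) (ρA (K₀ + K) p.2) (istar' K)}) +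
        ∑ p : Fin S × τ, ∑ ω : τ → Bool, (PB (K₀ + K)).real ((⋂ t, (uB (K₀ + K) t) ⁻¹' (if ω t then Iio (θ (K₀ + K) t * (1 - c₁ * ϑ ^ K₀ * ϑ ^ K) ^ istar' K) else Ici (θ (K₀ + K) t * (1 - c₁ * ϑ ^ K₀ * ϑ ^ K) ^ istar' K))) ∩ {x | p.2 ∈ testsB (K₀ + K) p.1 (Nat.rec (motive := fun _ => α) (aB (K₀ + K)) (fun σ a => nextB (K₀ + K) σ a ((testsB (K₀ + K) σ a).filter fun t => ω t = true)) p.1) ∧ uB (K₀ + K) p.2 x ∈ twoSidedShell (θ (K₀ + K) p.2) (c₁ * ϑ ^ K₀ * ϑ ^ K) (ρB (K₀ + K) p.2) (istar' K)}))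
      (A := fun K (_ : ℝ) (ω : τ → Bool) => (PA K).real (⋂ t, (uA K t) ⁻¹' (if ω t then Iio (θ K t * (1 - c₁ * ϑ ^ K) ^ (fun K => if K < K₀ then 0 else istar' (K - K₀)) K) else Ici (θ K t * (1 - c₁ * ϑ ^ K) ^ (fun K => if K < K₀ then 0 else istar' (K - K₀)) K))))
      (B := fun K (_ : ℝ) (ω : τ → Bool) => (PB K).real (⋂ t, (uB K t) ⁻¹' (if ω t then Iio (θ K t * (1 - c₁ * ϑ ^ K) ^ (fun K => if K < K₀ then 0 else istar' (K - K₀)) K) else Ici (θ K t * (1 - c₁ * ϑ ^ K) ^ (fun K => if K < K₀ then 0 else istar' (K - K₀)) K))))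
      (shA := fun K (_ : ℝ) (ω : τ → Bool) => (PA K).real ((⋂ t, (uA K t) ⁻¹' (if ω t then Iio (θ K t * (1 - c₁ * ϑ ^ K) ^ (fun K => if K < K₀ then 0 else istar' (K - K₀)) K) else Ici (θ K t * (1 - c₁ * ϑ ^ K) ^ (fun K => if K < K₀ then 0 else istar' (K - K₀)) K))) ∩ ⋃ p : Fin S × τ, {x | p.2 ∈ testsA K p.1 (Nat.rec (motive := fun _ => α) (aA K) (fun σ a => nextA K σ a ((testsA K σ a).filter fun t => ω t = true)) p.1) ∧ uA K p.2 x ∈ twoSidedShell (θ K p.2) (c₁ * ϑ ^ K) (ρA K p.2) ((fun K => if K < K₀ then 0 else istar' (K - K₀)) K)}))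
      (shB := fun K (_ : ℝ) (ω : τ → Bool) => (PB K).real ((⋂ t, (uB K t) ⁻¹' (if ω t then Iio (θ K t * (1 - c₁ * ϑ ^ K) ^ (fun K => if K < K₀ then 0 else istar' (K - K₀)) K) else Ici (θ K t * (1 - c₁ * ϑ ^ K) ^ (fun K => if K < K₀ then 0 else istar' (K - K₀)) K))) ∩ ⋃ p : Fin S × τ, {x | p.2 ∈ testsB K p.1 (Nat.rec (motive := fun _ => α) (aB K) (fun σ a => nextB K σ a ((testsB K σ a).filter fun t => ω t = true)) p.1) ∧ uB K p.2 x ∈ twoSidedShell (θ K p.2) (c₁ * ϑ ^ K) (ρB K p.2) ((fun K => if K < K₀ then 0 else istar' (K - K₀)) K)}))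
      K₀ ?_ (fun K hK => by simp only [hK, if_true]) (fun K => ?_)
      (fun K _ t _ ω _ => measureReal_nonneg) (fun K _ t _ ω _ => measureReal_mono Set.inter_subset_left)
      (fun K _ t _ ω _ => measureReal_nonneg) (fun K _ t _ ω _ => measureReal_mono Set.inter_subset_left)
    · simpa only [hlt, if_false, Nat.add_sub_cancel_left, key] using hSWB
    · simp only [hlt, if_false, Nat.add_sub_cancel_left, key]

end AdaptiveTree

/-! ## §3 The member OF RECORD on adaptive trees under any joint law, closeness and window bookkeeping only for `K ≥ K₀` -/

section Record

variable {α τ : Type*} [DecidableEq α] [Fintype τ] [DecidableEq τ] {S : ℕ}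
  {ΩA ΩB : ℕ → Type*} [∀ K, MeasurableSpace (ΩA K)] [∀ K, MeasurableSpace (ΩB K)]
  (PA : ∀ K, Measure (ΩA K)) (PB : ∀ K, Measure (ΩB K)) [∀ K, IsProbabilityMeasure (PA K)] [∀ K, IsProbabilityMeasure (PB K)]
  (uA : ∀ K, τ → ΩA K → ℝ) (uB : ∀ K, τ → ΩB K → ℝ) (θ ρA ρB : ℕ → τ → ℝ) (ρs : ℕ → ℝ) (levA levB : ℕ → τ → ℕ)
  (testsA testsB : ℕ → ℕ → α → Finset τ) (nextA nextB : ℕ → ℕ → α → Finset τ → α) (aA aB : ℕ → α) (ν : ℕ → ℕ → ℕ)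

/-- **THE MEMBER OF RECORD WITH CLOSENESS AND WINDOW BOOKKEEPING ONLY EVENTUALLY.**  File 52's `shellWeightBound_globalAdaptiveTree` (per-comparison
probability spaces, measurable observables, levels, thresholds `θ ≥ 0`, relative shell widths `0 ≤ ρ⋆_j ≤ 1`, per-run ADAPTIVE trees booking at most `ν_{j,σ}`
tests of level `j` at stage `σ`, ONE global assignment `c` by level) with the two-run closeness `2ρ^X_{K,t} ≤ ρ⋆_{lev}`, the live-window reading
`lev^X K t ∈ W K`, the per-level budgets `ν_{j,σ}` and the window majorant `Σ_{j∈W K} t_j·(2·#B_j·V_j∕n_j) ≤ C·ϑ^K` asked ONLY for `K ≥ K₀` (`K₀` arbitrary;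
below it radii `≥ 0`, levels and trees arbitrary).  Conclusion: ONE global `c` (`c j < n_j`) and `T4IndicatorShell.ShellWeightBound` BY NAME with weights `1` below `K₀` and the two runs' total
booked-shell mass at `c` from `K₀` on.  Proof: file 52 at the shifted data (books `B_j ↦ (B_j − K₀)`, `#` does not grow; constant `C·ϑ^{K₀}`), then §1 —
here NO constant needs rewriting, the member of record's factors are indexed by LEVEL, not by comparison. [folklore] -/
theorem shellWeightBound_globalAdaptiveTree_eventually (K₀ : ℕ) (l₀ : ℝ) {C ϑ : ℝ} (n : ℕ → ℕ) (hn : ∀ j, 0 < n j) (B W : ℕ → Finset ℕ) (hWB : ∀ K j, j ∈ W K → K ∈ B j) (huA : ∀ K t, Measurable (uA K t)) (huB : ∀ K t, Measurable (uB K t)) (hθ : ∀ K t, 0 ≤ θ K t) (hs0 : ∀ j, 0 ≤ ρs j) (hs1 : ∀ j, ρs j ≤ 1) (hA0 : ∀ K t, 0 ≤ ρA K t) (hA2 : ∀ K, K₀ ≤ K → ∀ t, 2 * ρA K t ≤ ρs (levA K t)) (hB0 : ∀ K t, 0 ≤ ρB K t) (hB2 : ∀ K, K₀ ≤ K → ∀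 t, 2 * ρB K t ≤ ρs (levB K t)) (hlevA : ∀ K, K₀ ≤ K → ∀ t, levA K t ∈ W K) (hlevB : ∀ K, K₀ ≤ K → ∀ t, levB K t ∈ W K)
    (hνA : ∀ K, K₀ ≤ K → ∀ j σ a, ((testsA K σ a).filter fun t => levA K t = j).card ≤ ν j σ)
    (hνB : ∀ K, K₀ ≤ K → ∀ j σ a, ((testsB K σ a).filter fun t => levB K t = j).card ≤ ν j σ)
    (tl : ℕ → ℝ) (htl0 : ∀ j, 0 < tl j) (htl : ∀ J, ∑ j ∈ range J, (tl j)⁻¹ < 1) (hϑ0 : 0 ≤ ϑ) (hϑ1 : ϑ < 1)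
    (hgeo : ∀ K, K₀ ≤ K → ∑ j ∈ W K, tl j * (2 * ((B j).card : ℝ) * (((2 * ∏ σ ∈ range S, (ν j σ + 1) - 2 : ℕ) : ℝ)) / n j) ≤ C * ϑ ^ K) :
    ∃ c : ℕ → ℕ, (∀ j, c j < n j) ∧
      ∃ Wsh : ℕ → ℝ, (∀ K, K < K₀ → Wsh K = 1) ∧
      (∀ K, K₀ ≤ K → Wsh K = ∑ p : Fin S × τ, ∑ ω : τ → Bool, (PA K).real ((⋂ t, (uA K t) ⁻¹' (if ω t then Iio (θ K t * (1 - ρs (levA K t)) ^ c (levA K t)) else Ici (θ K t * (1 - ρs (levA K t)) ^ c (levA K t)))) ∩ {x | p.2 ∈ testsA K p.1 (Nat.rec (motive := fun _ => α) (aA K) (fun σ a => nextA K σ a ((testsA K σ a).filter fun t => ω t = true)) p.1) ∧ uA K p.2 x ∈ twoSidedShell (θ K p.2) (ρs (levA K p.2)) (ρA K p.2) (c (levA K p.2))}) + ∑ p : Fin S × τ, ∑ ω : τ → Bool, (PB K).real ((⋂ t,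
                (uB K t) ⁻¹' (if ω t then Iio (θ K t * (1 - ρs (levB K t)) ^ c (levB K t)) else Ici (θ K t * (1 - ρs (levB K t)) ^ c (levB K t)))) ∩ {x | p.2 ∈ testsB K p.1
                (Nat.rec (motive := fun _ => α) (aB K) (fun σ a => nextB K σ a ((testsB K σ a).filter fun t => ω t = true)) p.1) ∧ uB K p.2 x ∈ twoSidedShell (θ K p.2) (ρs
                (levB K p.2)) (ρB K p.2) (c (levB K p.2))})) ∧
      T4IndicatorShell.ShellWeightBound l₀ (fun _ => (univ : Finset (τ → Bool)))
        (fun K (_ : ℝ) (ω : τ → Bool) => (PA K).real (⋂ t, (uA K t) ⁻¹' (if ω t then Iio (θ K t * (1 - ρs (levA K t)) ^ c (levA K t)) else Ici (θ K t * (1 - ρs (levA K t)) ^ c (levA K t)))))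
        (fun K (_ : ℝ) (ω : τ → Bool) => (PB K).real (⋂ t, (uB K t) ⁻¹' (if ω t then Iio (θ K t * (1 - ρs (levB K t)) ^ c (levB K t)) else Ici (θ K t * (1 - ρs (levB K t)) ^ c (levB K t)))))
        (fun K (_ : ℝ) (ω : τ → Bool) => (PA K).real ((⋂ t, (uA K t) ⁻¹' (if ω t then Iio (θ K t * (1 - ρs (levA K t)) ^ c (levA K t)) else Ici (θ K t * (1 - ρs (levA K t)) ^ c (levA K t)))) ∩ ⋃ p : Fin S × τ, {x | p.2 ∈ testsA K p.1 (Nat.rec (motive := fun _ => α) (aA K) (fun σ a => nextA K σ a ((testsA K σ a).filter fun t => ω t = true)) p.1) ∧ uA K p.2 x ∈ twoSidedShell (θ K p.2) (ρs (levA K p.2)) (ρA K p.2) (c (levA K p.2))}))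
        (fun K (_ : ℝ) (ω : τ → Bool) => (PB K).real ((⋂ t, (uB K t) ⁻¹' (if ω t then Iio (θ K t * (1 - ρs (levB K t)) ^ c (levB K t)) else Ici (θ K t * (1 - ρs (levB K t)) ^ c (levB K t)))) ∩ ⋃ p : Fin S × τ, {x | p.2 ∈ testsB K p.1 (Nat.rec (motive := fun _ => α) (aB K) (fun σ a => nextB K σ a ((testsB K σ a).filter fun t => ω t = true)) p.1) ∧ uB K p.2 x ∈ twoSidedShell (θ K p.2) (ρs (levB K p.2)) (ρB K p.2) (c (levB K p.2))}))
        Wsh := by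
  have hlt : ∀ K, ¬ K₀ + K < K₀ := fun K => by omega
  have hBc : ∀ j, ((((B j).image fun K => K - K₀).card : ℕ) : ℝ) ≤ ((B j).card : ℝ) := fun j => by exact_mod_cast Finset.card_image_le
  have hgeo' : ∀ K, ∑ j ∈ W (K₀ + K), tl j * (2 * ((((B j).image fun K => K - K₀).card : ℕ) : ℝ) * (((2 * ∏ σ ∈ range S, (ν j σ + 1) - 2 : ℕ) : ℝ)) / n j)
      ≤ (C * ϑ ^ K₀) * ϑ ^ K := by
    intro K
    refine le_trans (Finset.sum_le_sum fun j _ => ?_) ((hgeo (K₀ + K) (Nat.le_add_right K₀ K)).trans_eq (by rw [pow_add, mul_assoc]))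
    have h1 : 0 ≤ tl j := (htl0 j).le
    have h2 : (0 : ℝ) ≤ (((2 * ∏ σ ∈ range S, (ν j σ + 1) - 2 : ℕ) : ℝ)) := Nat.cast_nonneg _
    have h3 : (0 : ℝ) < n j := by exact_mod_cast hn j
    have h4 := hBc j
    gcongr
  obtain ⟨c, hc, hSWB⟩ := shellWeightBound_globalAdaptiveTree (S := S) (PA := fun K => PA (K₀ + K)) (PB := fun K => PB (K₀ + K))
    (uA := fun K => uA (K₀ + K)) (uB := fun K => uB (K₀ + K)) (θ := fun K => θ (K₀ + K)) (ρA := fun K => ρA (K₀ + K)) (ρB := fun K => ρB (K₀ + K))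
    (ρs := ρs) (levA := fun K => levA (K₀ + K)) (levB := fun K => levB (K₀ + K))
    (testsA := fun K => testsA (K₀ + K)) (testsB := fun K => testsB (K₀ + K)) (nextA := fun K => nextA (K₀ + K)) (nextB := fun K => nextB (K₀ + K))
    (aA := fun K => aA (K₀ + K)) (aB := fun K => aB (K₀ + K)) (ν := ν) l₀ (C := C * ϑ ^ K₀) (ϑ := ϑ) n hn
    (fun j => (B j).image fun K => K - K₀) (fun K => W (K₀ + K))
    (fun K j hj => Finset.mem_image.mpr ⟨K₀ + K, hWB (K₀ + K) j hj, Nat.add_sub_cancel_left K₀ K⟩)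
    (fun K t => huA (K₀ + K) t) (fun K t => huB (K₀ + K) t) (fun K t => hθ (K₀ + K) t) hs0 hs1
    (fun K t => hA0 (K₀ + K) t) (fun K t => hA2 (K₀ + K) (Nat.le_add_right K₀ K) t) (fun K t => hB0 (K₀ + K) t) (fun K t => hB2 (K₀ + K) (Nat.le_add_right K₀ K) t)
    (fun K t => hlevA (K₀ + K) (Nat.le_add_right K₀ K) t) (fun K t => hlevB (K₀ + K) (Nat.le_add_right K₀ K) t)
    (fun K j σ a => hνA (K₀ + K) (Nat.le_add_right K₀ K) j σ a) (fun K j σ a => hνB (K₀ + K) (Nat.le_add_right K₀ K) j σ a) tl htl0 htl hϑ0 hϑ1 hgeo'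
  refine ⟨c, hc, fun K => if K < K₀ then (1 : ℝ) else ∑ p : Fin S × τ, ∑ ω : τ → Bool, (PA K).real ((⋂ t, (uA K t) ⁻¹' (if ω t then Iio (θ K t * (1 - ρs (levA K t)) ^ c (levA K t)) else Ici (θ K t * (1 - ρs (levA K t)) ^ c (levA K t)))) ∩ {x | p.2 ∈ testsA K p.1 (Nat.rec (motive := fun _ => α) (aA K) (fun σ a => nextA K σ a ((testsA K σ a).filter fun t => ω t = true)) p.1) ∧ uA K p.2 x ∈ twoSidedShell (θ K p.2) (ρs (levA K p.2)) (ρA K p.2) (c (levA K p.2))}) + ∑ p : Fin S × τ, ∑ ω : τ → Bool, (PB K).real ((⋂ t,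
                (uB K t) ⁻¹' (if ω t then Iio (θ K t * (1 - ρs (levB K t)) ^ c (levB K t)) else Ici (θ K t * (1 - ρs (levB K t)) ^ c (levB K t)))) ∩ {x | p.2 ∈ testsB K p.1
                (Nat.rec (motive := fun _ => α) (aB K) (fun σ a => nextB K σ a ((testsB K σ a).filter fun t => ω t = true)) p.1) ∧ uB K p.2 x ∈ twoSidedShell (θ K p.2) (ρs
                (levB K p.2)) (ρB K p.2) (c (levB K p.2))}), fun K hK => by simp only [hK, if_true], fun K hK => by simp only [not_lt.mpr hK, if_false], ?_⟩
  exact shellWeightBound_of_shift (T := fun _ => (univ : Finset (τ → Bool)))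
    (A := (fun K (_ : ℝ) (ω : τ → Bool) => (PA K).real (⋂ t, (uA K t) ⁻¹' (if ω t then Iio (θ K t * (1 - ρs (levA K t)) ^ c (levA K t)) else Ici (θ K t * (1 - ρs (levA K t)) ^ c (levA K t))))))
    (B := (fun K (_ : ℝ) (ω : τ → Bool) => (PB K).real (⋂ t, (uB K t) ⁻¹' (if ω t then Iio (θ K t * (1 - ρs (levB K t)) ^ c (levB K t)) else Ici (θ K t * (1 - ρs (levB K t)) ^ c (levB K t))))))
    (shA := (fun K (_ : ℝ) (ω : τ → Bool) => (PA K).real ((⋂ t, (uA K t) ⁻¹' (if ω t then Iio (θ K t * (1 - ρs (levA K t)) ^ c (levA K t)) else Ici (θ K t * (1 - ρs (levA K t)) ^ c (levA K t)))) ∩ ⋃ p : Fin S × τ, {x | p.2 ∈ testsA K p.1 (Nat.rec (motive := fun _ => α) (aA K) (fun σ a => nextA K σ a ((testsA K σ a).filter fun t => ω t = true)) p.1) ∧ uA K p.2 x ∈ twoSidedShell (θ K p.2) (ρs (levA K p.2)) (ρA K p.2) (c (levA K p.2))})))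
    (shB := (fun K (_ : ℝ) (ω : τ → Bool) => (PB K).real ((⋂ t, (uB K t) ⁻¹' (if ω t then Iio (θ K t * (1 - ρs (levB K t)) ^ c (levB K t)) else Ici (θ K t * (1 - ρs (levB K t)) ^ c (levB K t)))) ∩ ⋃ p : Fin S × τ, {x | p.2 ∈ testsB K p.1 (Nat.rec (motive := fun _ => α) (aB K) (fun σ a => nextB K σ a ((testsB K σ a).filter fun t => ω t = true)) p.1) ∧ uB K p.2 x ∈ twoSidedShell (θ K p.2) (ρs (levB K p.2)) (ρB K p.2) (c (levB K p.2))})))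
    K₀ hSWB (fun K hK => by simp only [hK, if_true]) (fun K => by simp only [hlt, if_false])
    (fun K _ t _ ω _ => measureReal_nonneg) (fun K _ t _ ω _ => measureReal_mono Set.inter_subset_left)
    (fun K _ t _ ω _ => measureReal_nonneg) (fun K _ t _ ω _ => measureReal_mono Set.inter_subset_left)

end Record

/-! ## §4 Member (δ-1) on CONSECUTIVE LATTICES of any torus scheme (file 50 §5, closeness only for `K ≥ K₀`) -/

section Lattice

variable {α : Type*} [DecidableEq α] {τ : Type*} [Fintype τ] [DecidableEq τ] {S : ℕ}
  {G : Type*} [GaugeGroup G] [MeasurableSpace G] [RegularGaugeGroup G] [HaarData G] {O : Type*} (Sch : Missing.TorusScheme G O)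
  (pA : ∀ K, τ → Plaq (Sch.P K) 0) (pB : ∀ K, τ → Plaq (Sch.P (K + 1)) 0) (θ ρA ρB : ℕ → τ → ℝ)
  (testsA testsB : ℕ → ℕ → α → Finset τ) (nextA nextB : ℕ → ℕ → α → Finset τ → α) (aA aB : ℕ → α) (ν : ℕ → ℕ)

/-- **ROAD (δ)'s CONSTRUCTOR ON THE LATTICE WITH CLOSENESS ONLY EVENTUALLY**: file 50's `shellWeightBound_wilsonScheme_adaptive` (ANY regular gauge group, ANY
torus scheme `Sch` with `β_K ≥ 0`, run A = Wilson–Gibbs at cutoff `K`, run B at `K + 1`, plaquette-action tests `1 − Re tr U(∂p)` booked through each run's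
OWN arbitrary adaptive tree) with the two-run closeness `2ρ^X_{K,t} ≤ c₁ϑ^K` and the stage budgets asked only for `K ≥ K₀`: §2 at the Gibbs laws.  MODEL: the trees are ARBITRARY
(node O). [folklore] -/
theorem shellWeightBound_wilsonScheme_adaptive_eventually (hβ : ∀ K, 0 ≤ Sch.β K) (K₀ : ℕ) (l₀ : ℝ) {c₁ β' ϑ : ℝ} (hc₁ : 0 < c₁) (h2 : 2 * c₁ ≤ β') (hβ1 : β' ≤ 1)
    (hϑ0 : 0 < ϑ) (hϑ1 : ϑ < 1) (hθ : ∀ K t, 0 ≤ θ K t)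
    (hA0 : ∀ K t, 0 ≤ ρA K t) (hA2 : ∀ K, K₀ ≤ K → ∀ t, 2 * ρA K t ≤ c₁ * ϑ ^ K) (hB0 : ∀ K t, 0 ≤ ρB K t)
    (hB2 : ∀ K, K₀ ≤ K → ∀ t, 2 * ρB K t ≤ c₁ * ϑ ^ K) (hνA : ∀ K, K₀ ≤ K → ∀ σ a, (testsA K σ a).card ≤ ν σ)
    (hνB : ∀ K, K₀ ≤ K → ∀ σ a, (testsB K σ a).card ≤ ν σ) :
    ∃ istar : ℕ → ℕ, ∃ Wsh : ℕ → ℝ, (∀ K, K < K₀ → Wsh K = 1) ∧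
      (∀ K, K₀ ≤ K → istar K < ⌊β' / (c₁ * ϑ ^ K)⌋₊ ∧
        ∑ p : Fin S × τ, ∑ ω : τ → Bool, (T4GenFunBounds.gibbsMeasure (G := G) (Sch.P K) (Sch.β K)).real ((⋂ t, (fun U : GaugeField (Sch.P K) 0 G => 1 - Missing.plaqLoop (pA K t) U) ⁻¹' (if ω t then Iio (θ K t * (1 - c₁ * ϑ ^ K) ^ istar K) else Ici (θ K t * (1 - c₁ * ϑ ^ K) ^ istar K))) ∩ {x | p.2 ∈ testsA K p.1 (Nat.rec (motive := fun _ => α) (aA K) (fun σ a => nextA K σ a ((testsA K σ a).filter fun t => ω t = true)) p.1) ∧ (fun U : GaugeField (Sch.P K) 0 G => 1 - Missing.plaqLoop (pA K p.2) U) x ∈ twoSidedShell (θ K p.2) (c₁ * ϑ ^ K) (ρA K p.2) (istar K)}) ≤ (((2 * ∏ σ ∈ range S, (ν σ + 1) - 2 : ℕ) : ℝ) * (4 * c₁ / β')) * ϑ ^ K ∧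
        ∑ p : Fin S × τ, ∑ ω : τ → Bool, (T4GenFunBounds.gibbsMeasure (G := G) (Sch.P (K + 1)) (Sch.β (K + 1))).real ((⋂ t, (fun U : GaugeField (Sch.P (K + 1)) 0 G => 1 - Missing.plaqLoop (pB K t) U) ⁻¹' (if ω t then Iio (θ K t * (1 - c₁ * ϑ ^ K) ^ istar K) else Ici (θ K t * (1 - c₁ * ϑ ^ K) ^ istar K))) ∩ {x | p.2 ∈ testsB K p.1 (Nat.rec (motive := fun _ => α) (aB K) (fun σ a => nextB K σ a ((testsB K σ a).filter fun t => ω t = true)) p.1) ∧ (fun U : GaugeField (Sch.P (K + 1)) 0 G => 1 - Missing.plaqLoop (pB K p.2) U) x ∈ twoSidedShell (θ K p.2) (c₁ * ϑ ^ K) (ρB K p.2) (istar K)}) ≤ (((2 * ∏ σ ∈ range S, (ν σ + 1) - 2 : ℕ) : ℝ) * (4 * c₁ / β')) * ϑ ^ K ∧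
        Wsh K = ∑ p : Fin S × τ, ∑ ω : τ → Bool, (T4GenFunBounds.gibbsMeasure (G := G) (Sch.P K) (Sch.β K)).real ((⋂ t, (fun U : GaugeField (Sch.P K) 0 G => 1 - Missing.plaqLoop (pA K t) U) ⁻¹' (if ω t then Iio (θ K t * (1 - c₁ * ϑ ^ K) ^ istar K) else Ici (θ K t * (1 - c₁ * ϑ ^ K) ^ istar K))) ∩ {x | p.2 ∈ testsA K p.1 (Nat.rec (motive := fun _ => α) (aA K) (fun σ a => nextA K σ a ((testsA K σ a).filter fun t => ω t = true)) p.1) ∧ (fun U : GaugeField (Sch.P K) 0 G => 1 - Missing.plaqLoop (pA K p.2) U) x ∈ twoSidedShell (θ K p.2) (c₁ * ϑ ^ K) (ρA K p.2) (istar K)}) +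
          ∑ p : Fin S × τ, ∑ ω : τ → Bool, (T4GenFunBounds.gibbsMeasure (G := G) (Sch.P (K + 1)) (Sch.β (K + 1))).real ((⋂ t, (fun U : GaugeField (Sch.P (K + 1)) 0 G => 1 - Missing.plaqLoop (pB K t) U) ⁻¹' (if ω t then Iio (θ K t * (1 - c₁ * ϑ ^ K) ^ istar K) else Ici (θ K t * (1 - c₁ * ϑ ^ K) ^ istar K))) ∩ {x | p.2 ∈ testsB K p.1 (Nat.rec (motive := fun _ => α) (aB K) (fun σ a => nextB K σ a ((testsB K σ a).filter fun t => ω t = true)) p.1) ∧ (fun U : GaugeField (Sch.P (K + 1)) 0 G => 1 - Missing.plaqLoop (pB K p.2) U) x ∈ twoSidedShell (θ K p.2) (c₁ * ϑ ^ K) (ρB K p.2) (istar K)})) ∧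
      T4IndicatorShell.ShellWeightBound l₀ (fun _ => (univ : Finset (τ → Bool)))
        (fun K (_ : ℝ) (ω : τ → Bool) => (T4GenFunBounds.gibbsMeasure (G := G) (Sch.P K) (Sch.β K)).real (⋂ t, (fun U : GaugeField (Sch.P K) 0 G => 1 - Missing.plaqLoop (pA K t) U) ⁻¹' (if ω t then Iio (θ K t * (1 - c₁ * ϑ ^ K) ^ istar K) else Ici (θ K t * (1 - c₁ * ϑ ^ K) ^ istar K))))
        (fun K (_ : ℝ) (ω : τ → Bool) => (T4GenFunBounds.gibbsMeasure (G := G) (Sch.P (K + 1)) (Sch.β (K + 1))).real (⋂ t, (fun U : GaugeField (Sch.P (K + 1)) 0 G => 1 - Missing.plaqLoop (pB K t) U) ⁻¹' (if ω t then Iio (θ K t * (1 - c₁ * ϑ ^ K) ^ istar K) else Ici (θ K t * (1 - c₁ * ϑ ^ K) ^ istar K))))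
        (fun K (_ : ℝ) (ω : τ → Bool) => (T4GenFunBounds.gibbsMeasure (G := G) (Sch.P K) (Sch.β K)).real ((⋂ t, (fun U : GaugeField (Sch.P K) 0 G => 1 - Missing.plaqLoop (pA K t) U) ⁻¹' (if ω t then Iio (θ K t * (1 - c₁ * ϑ ^ K) ^ istar K) else Ici (θ K t * (1 - c₁ * ϑ ^ K) ^ istar K))) ∩ ⋃ p : Fin S × τ, {x | p.2 ∈ testsA K p.1 (Nat.rec (motive := fun _ => α) (aA K) (fun σ a => nextA K σ a ((testsA K σ a).filter fun t => ω t = true)) p.1) ∧ (fun U : GaugeField (Sch.P K) 0 G => 1 - Missing.plaqLoop (pA K p.2) U) x ∈ twoSidedShell (θ K p.2) (c₁ * ϑ ^ K) (ρA K p.2) (istar K)}))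
        (fun K (_ : ℝ) (ω : τ → Bool) => (T4GenFunBounds.gibbsMeasure (G := G) (Sch.P (K + 1)) (Sch.β (K + 1))).real ((⋂ t, (fun U : GaugeField (Sch.P (K + 1)) 0 G => 1 - Missing.plaqLoop (pB K t) U) ⁻¹' (if ω t then Iio (θ K t * (1 - c₁ * ϑ ^ K) ^ istar K) else Ici (θ K t * (1 - c₁ * ϑ ^ K) ^ istar K))) ∩ ⋃ p : Fin S × τ, {x | p.2 ∈ testsB K p.1 (Nat.rec (motive := fun _ => α) (aB K) (fun σ a => nextB K σ a ((testsB K σ a).filter fun t => ω t = true)) p.1) ∧ (fun U : GaugeField (Sch.P (K + 1)) 0 G => 1 - Missing.plaqLoop (pB K p.2) U) x ∈ twoSidedShell (θ K p.2) (c₁ * ϑ ^ K) (ρB K p.2) (istar K)}))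
        Wsh := by
  haveI : ∀ K, IsProbabilityMeasure (T4GenFunBounds.gibbsMeasure (G := G) (Sch.P K) (Sch.β K)) := fun K => T4GenFunBounds.isProbabilityMeasure_gibbsMeasure _ (hβ K)
  haveI : ∀ K, IsProbabilityMeasure (T4GenFunBounds.gibbsMeasure (G := G) (Sch.P (K + 1)) (Sch.β (K + 1))) := fun K =>
    T4GenFunBounds.isProbabilityMeasure_gibbsMeasure _ (hβ (K + 1))
  exact shellWeightBound_adaptiveTree_eventually (ΩA := fun K => GaugeField (Sch.P K) 0 G) (ΩB := fun K => GaugeField (Sch.P (K + 1)) 0 G)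
    (fun K => T4GenFunBounds.gibbsMeasure (G := G) (Sch.P K) (Sch.β K)) (fun K => T4GenFunBounds.gibbsMeasure (G := G) (Sch.P (K + 1)) (Sch.β (K + 1)))
    (fun K t (U : GaugeField (Sch.P K) 0 G) => 1 - Missing.plaqLoop (pA K t) U)
    (fun K t (U : GaugeField (Sch.P (K + 1)) 0 G) => 1 - Missing.plaqLoop (pB K t) U) θ ρA ρB testsA testsB nextA nextB aA aB ν
    K₀ l₀ hc₁ h2 hβ1 hϑ0 hϑ1
    (fun K t => measurable_const.sub (Missing.measurable_plaqLoop' (pA K t)))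
    (fun K t => measurable_const.sub (Missing.measurable_plaqLoop' (pB K t))) hθ hA0 hA2 hB0 hB2 hνA hνB

end Lattice

end Summit.QuantumFields.BalabanUV.T4Continuum.Spine.NE7c.LiveFactorEventually

end
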